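import Literature.AnabelianGeometry.SemiGraphs.TemperedPiSystem

/-!
# The projections `π₁^temp(𝒢) → Gal(𝒢_{∞,n}/𝒢)` are surjective ([SemiAnbd] Prop. 3.6, p. 38) — proofs

Proof-only file.  For Galois level data `D`, the limit projections
`ρ_n : π₁^temp = lim_k G_k → G_n` are surjective: an element of `G_n` extends to a compatible
sequence by successive choices of preimages under the surjections `step : G_{k+1} → G_k`
(dependent choice along `ℕ`).  Needed for the fullness of the fibre functor
`B^temp(𝒢) ⥤ B^temp(π₁^temp(𝒢))`.
-/

namespace Literature.AnabelianGeometry.SemiGraphs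

namespace ProfiniteSemiGraph

open CategoryTheory

universe u

variable {𝒢 : ProfiniteSemiGraph.{u}}

namespace GaloisLevelData

variable (D : GaloisLevelData 𝒢) (h𝒢 : 𝒢.IsCountable) (n : ℕ) (σ : D.Gal h𝒢 n)

/-- A tail of preimages of `σ`: `tail m ∈ G_{n+m}`, `tail 0 = σ`, `step (tail (m+1)) = tail m`.
[cite: MochizukiSemiAnbd2006, Prop 3.6 p.38] -/
private noncomputable def tail : ∀ m : ℕ, D.Gal h𝒢 (n + m)
  | 0 => σ
  | m + 1 => (D.step_surjective h𝒢 (n + m) (tail m)).choose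

/-- The defining property of the tail. [folklore] -/
private theorem step_tail (m : ℕ) :
    D.step h𝒢 (n + m) (tail D h𝒢 n σ (m + 1)) = tail D h𝒢 n σ m :=
  (D.step_surjective h𝒢 (n + m) (tail D h𝒢 n σ m)).choose_spec

/-- The tail is compatible with the transition maps. [folklore] -/
private theorem mapLE_tail {m m' : ℕ} (h : m ≤ m') :
    D.mapLE h𝒢 (Nat.add_le_add_left h n) (tail D h𝒢 n σ m') = tail D h𝒢 n σ m := by
  induction m', h using Nat.le_induction with
  | base => rw [mapLE_self]; rfl
  | succ k hk ih =>
    rw [D.mapLE_succ h𝒢 (Nat.add_le_add_left hk n), MonoidHom.comp_apply]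
    change D.mapLE h𝒢 _ (D.step h𝒢 (n + k) (tail D h𝒢 n σ (k + 1))) = _
    rw [step_tail]
    exact ih

/-- The compatible sequence through `σ`: `seq k := mapLE (tail k) ∈ G_k`. [folklore] -/
private noncomputable def seq (k : ℕ) : D.Gal h𝒢 k :=
  D.mapLE h𝒢 (Nat.le_add_left k n) (tail D h𝒢 n σ k)

/-- The sequence is compatible. [folklore] -/
private theorem mapLE_seq {i j : ℕ} (h : i ≤ j) :
    D.mapLE h𝒢 h (seq D h𝒢 n σ j) = seq D h𝒢 n σ i := by
  unfold seq
  rw [D.mapLE_trans, ← mapLE_tail D h𝒢 n σ h, D.mapLE_trans]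

/-- The sequence passes through `σ`. [folklore] -/
private theorem seq_n : seq D h𝒢 n σ n = σ := by
  unfold seq
  have h := mapLE_tail D h𝒢 n σ (Nat.zero_le n)
  exact h

/-- **The projections `ρ_n : π₁^temp(𝒢) → G_n` are surjective.** [cite: MochizukiSemiAnbd2006, Prop 3.6 p.38] -/
theorem proj_surjective : Function.Surjective (D.proj h𝒢 n) := by
  intro σ
  refine ⟨⟨fun k => seq D h𝒢 n σ k.down, ?_⟩, ?_⟩
  · rw [CountableDiscreteSystem.mem_limit_iff]
    intro i j h
    exact mapLE_seq D h𝒢 n σ h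
  · exact seq_n D h𝒢 n σ

end GaloisLevelData

end ProfiniteSemiGraph

end Literature.AnabelianGeometry.SemiGraphs
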